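import Mathlib
import Literature.Computability.AlgebraicComplexity.PermanentIrreducible
import Literature.Computability.AlgebraicComplexity.StandardFamiliesProofs
import Summits.ValiantsHypothesis.ValiantsHypothesis.Theorems.DivisionGapPerCofactorDegreeReductionStubPositiveVanishingDegree
import Summits.ValiantsHypothesis.ValiantsHypothesis.Theorems.DivisionGapPerCofactorDegreeReductionWindowGlue

/-!
# Crux `DivisionGap.PerCofactorDegreeReduction` (stmt-ValiantsHypothesis-15046), line `Sketch` —
# stub `stub_parametrizedConicGap`: the positivity gap of the conic `F_θ`

**Theorem (`stub_parametrizedConicGap`).** Let `0 < θ < π` and let a nonzero `G ∈ ℝ[z₀, z₁, z₂]`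
with NONNEGATIVE coefficients kill the parametrisation
`P = (a(a+b), b(a+b), −(a² − 2cos θ·ab + b²))` of the conic
`F_θ = z₀² − 2cos θ z₀z₁ + z₁² + z₂(z₀+z₁)`, i.e. `G(P) = 0` in `ℝ[a, b]`.  Then `deg G · θ ≥ π/2`.

## Proof

Lift `G` to `ℝ≥0[z]` and induct on `deg G`.  Write `G = z₂ · G' + g` with `g` free of `z₂`
(`MvPolynomial.divMonomial` / `modMonomial`).

* **Points of the curve.**  For `ω = e^{iθ}` one has `ω² − 2cos θ·ω + 1 = 0`, so at the complex
  point `(a, b) = (ω s, s)` the parametrisation takes the value `(Λ s²)·(ω, 1, 0)` with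
  `Λ = ω + 1 ≠ 0` (`Im Λ = sin θ > 0`).  Since every complex number is `Λ s²` for some `s`, the
  relation `G(P) = 0` gives `G(c·(ω, 1, 0)) = 0` for every `c ∈ ℂ`, hence `g(c·(ω,1,0)) = 0`.
* **Case `g ≠ 0`.**  Expanding in homogeneous components, `g(c·x₀) = Σ_d c^d g_d(x₀)` is the zero
  polynomial in `c`, so `g_d(ω, 1, 0) = 0` for every `d` (`Polynomial.funext` over the infinite
  field `ℂ`).  Pick `d ≤ deg g ≤ deg G` with `g_d ≠ 0`; `g_d` is free of `z₂`, so its value at the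
  torus point `(e^{iθ}, e^{0}, e^{0}) = (ω, 1, 1)` is `g_d(ω, 1, 0) = 0`.  By the landed stub
  `stub_positiveVanishingDegree` (phases `(θ, 0, 0)`, `ε = θ`) this forces `d·θ ≥ π/2`.
* **Case `g = 0`.**  Then `G = z₂ · G'` with `G' ≠ 0`, `deg G = deg G' + 1`, and
  `G(P) = P₂ · G'(P) = 0` with `P₂ ≠ 0` in the domain `ℝ[a, b]`, so `G'(P) = 0` and the induction
  hypothesis applies to `G'`.
-/

noncomputable section

-- `Summit.ValiantsHypothesis.ValiantsHypothesis.…` is the tree's mandated single-conjunct layout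
-- (Problem = Summit), so the duplicated namespace component is intended.
set_option linter.dupNamespace false

namespace Summit.ValiantsHypothesis.ValiantsHypothesis.Theorems.DivisionGap.PerCofactorDegreeReduction.ParametrizedConicGap

open MvPolynomial Literature.Computability.AlgebraicComplexity
open Summit.ValiantsHypothesis.ValiantsHypothesis.Theorems.DivisionGap.PerCofactorDegreeReduction.PositiveVanishingDegree
  (stub_positiveVanishingDegree)
open Summit.ValiantsHypothesis.ValiantsHypothesis.Theorems.DivisionGap.PerCofactorDegreeReduction.Window
  (exists_lift_of_coeff_nonneg totalDegree_map_toRealHom)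
open scoped NNReal BigOperators

/-! ### Two elementary evaluation lemmas -/

-- adapted from `MvPolynomial.IsHomogeneous.eval_smul_eq`
-- (Literature/FieldTheory/QuasiAlgClosed/Basic.lean)
/-- **Scaling a form.** A form `p` of degree `n` satisfies `p(c • x) = c ^ n · p(x)` under any
evaluation `eval₂ f`. [folklore] -/
theorem eval₂_smul_of_isHomogeneous {σ R S : Type*} [CommSemiring R] [CommSemiring S]
    (f : R →+* S) {p : MvPolynomial σ R} {n : ℕ} (hp : p.IsHomogeneous n) (c : S) (x : σ → S) :
    eval₂ f (c • x) p = c ^ n * eval₂ f x p := by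
  classical
  rw [eval₂_eq, eval₂_eq, Finset.mul_sum]
  refine Finset.sum_congr rfl fun m hm => ?_
  have hdeg : ∑ i ∈ m.support, m i = n := (hp.degree_eq_sum_deg_support hm).symm
  simp only [Pi.smul_apply, smul_eq_mul, mul_pow, Finset.prod_mul_distrib,
    Finset.prod_pow_eq_pow_sum, hdeg]
  ring

/-- **Evaluation of a polynomial free of one variable.** If no monomial of `p` involves the
variable `i`, then `eval₂ f x p` does not depend on `x i`. [folklore] -/
theorem eval₂_congr_of_free {σ R S : Type*} [CommSemiring R] [CommSemiring S] (f : R →+* S)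
    {p : MvPolynomial σ R} {i : σ} (hp : ∀ m ∈ p.support, m i = 0) {x x' : σ → S}
    (h : ∀ j, j ≠ i → x j = x' j) : eval₂ f x p = eval₂ f x' p := by
  classical
  rw [eval₂_eq, eval₂_eq]
  refine Finset.sum_congr rfl fun m hm => ?_
  congr 1
  refine Finset.prod_congr rfl fun j hj => ?_
  rw [h j fun hji => ?_]
  subst hji
  exact (Finsupp.mem_support_iff.1 hj) (hp m hm)

/-! ### The remainder modulo `z_i` -/

/-- Coefficients of the remainder of `p` modulo `X i`: the monomials of `p` not involving `i`.
[folklore] -/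
theorem coeff_modMonomial_single {σ R : Type*} [CommSemiring R] (p : MvPolynomial σ R) (i : σ)
    (m : σ →₀ ℕ) :
    coeff m (p.modMonomial (Finsupp.single i 1)) = if m i = 0 then coeff m p else 0 := by
  split_ifs with h
  · exact coeff_modMonomial_of_not_le _
      (by rw [Finsupp.single_le_iff, h]; exact Nat.not_succ_le_zero 0)
  · exact coeff_modMonomial_of_le _
      (by rw [Finsupp.single_le_iff]; exact Nat.one_le_iff_ne_zero.2 h)

/-- The support of the remainder of `p` modulo `X i` consists of monomials of `p` free of `i`.
[folklore] -/
theorem mem_support_modMonomial_single {σ R : Type*} [CommSemiring R] {p : MvPolynomial σ R}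
    {i : σ} {m : σ →₀ ℕ} (hm : m ∈ (p.modMonomial (Finsupp.single i 1)).support) :
    m i = 0 ∧ m ∈ p.support := by
  rw [mem_support_iff, coeff_modMonomial_single] at hm
  by_cases h : m i = 0
  · rw [if_pos h] at hm
    exact ⟨h, mem_support_iff.2 hm⟩
  · rw [if_neg h] at hm
    exact (hm rfl).elim

/-! ### The analytic heart: a `z₂`-free nonnegative polynomial vanishing on `ℂ·(ω, 1, 0)` -/

/-- **Degree bound from vanishing on a complex line.** Let `θ > 0`, `ω = e^{iθ}`, and let
`g ∈ ℝ≥0[z₀, z₁, z₂]` be nonzero, free of `z₂`, with `g(c·(ω, 1, 0)) = 0` for every `c ∈ ℂ`.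
Then `deg g · θ ≥ π/2`.  Indeed `c ↦ g(c·(ω,1,0)) = Σ_d c^d g_d(ω,1,0)` is the zero polynomial, so
every homogeneous component vanishes at `(ω, 1, 0)`, hence (being free of `z₂`) at the torus point
`(ω, 1, 1)` of phases `(θ, 0, 0)`; a nonzero component `g_d` then has `d·θ ≥ π/2` by
`stub_positiveVanishingDegree`. [folklore] -/
theorem gap_of_vanishing (θ : ℝ) (hθ : 0 < θ) (g : MvPolynomial (Fin 3) ℝ≥0) (hg : g ≠ 0)
    (hsupp : ∀ m ∈ g.support, m 2 = 0)
    (hvan : ∀ c : ℂ, eval₂ (Complex.ofRealHom.comp NNReal.toRealHom)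
      (c • ![Complex.exp (θ * Complex.I), 1, 0]) g = 0) :
    Real.pi / 2 ≤ (g.totalDegree : ℝ) * θ := by
  set ω : ℂ := Complex.exp (θ * Complex.I) with hω
  set φ : ℝ≥0 →+* ℂ := Complex.ofRealHom.comp NNReal.toRealHom
  set x₀ : Fin 3 → ℂ := ![ω, 1, 0] with hx₀
  -- the coefficients `a_d = g_d(x₀)` of the one-variable polynomial `c ↦ g(c • x₀)`
  set a : ℕ → ℂ := fun d => eval₂ φ x₀ (homogeneousComponent d g)
  have hsum : ∀ c : ℂ, ∑ d ∈ Finset.range (g.totalDegree + 1), a d * c ^ d = 0 := by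
    intro c
    have h := hvan c
    conv_lhs at h => rw [← sum_homogeneousComponent g, eval₂_sum]
    rw [← h]
    refine Finset.sum_congr rfl fun d _ => ?_
    rw [eval₂_smul_of_isHomogeneous φ (homogeneousComponent_isHomogeneous d g) c x₀, mul_comm]
  have hQ : (∑ d ∈ Finset.range (g.totalDegree + 1), Polynomial.monomial d (a d)) = 0 := by
    apply Polynomial.funext
    intro c
    rw [Polynomial.eval_finsetSum, Polynomial.eval_zero]
    simp only [Polynomial.eval_monomial]
    exact hsum c
  have ha0 : ∀ d ∈ Finset.range (g.totalDegree + 1), a d = 0 := by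
    intro d hd
    have := congr_arg (fun q => Polynomial.coeff q d) hQ
    simpa only [Polynomial.finsetSum_coeff, Polynomial.coeff_monomial, Finset.sum_ite_eq',
      if_pos hd, Polynomial.coeff_zero] using this
  -- a nonzero homogeneous component `g_d`, `d ≤ deg g`
  obtain ⟨m, hm⟩ := support_nonempty.2 hg
  set d := m.degree
  have hFd : homogeneousComponent d g ≠ 0 := by
    intro h
    have := congr_arg (coeff m) h
    rw [coeff_homogeneousComponent, if_pos rfl, coeff_zero] at this
    exact (mem_support_iff.1 hm) this
  have hdle : d ≤ g.totalDegree := not_lt.1 fun h => hFd (homogeneousComponent_eq_zero _ _ h)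
  have hFdeg : (homogeneousComponent d g).totalDegree = d :=
    (homogeneousComponent_isHomogeneous d g).totalDegree hFd
  -- `g_d` is free of `z₂`
  have hFsupp : ∀ m' ∈ (homogeneousComponent d g).support, m' 2 = 0 := by
    intro m' hm'
    rw [support_homogeneousComponent, Finset.mem_filter] at hm'
    exact hsupp m' hm'.1
  by_contra hlt
  rw [not_le] at hlt
  have hdeg : ((homogeneousComponent d g).totalDegree : ℝ) * θ < Real.pi / 2 := by
    rw [hFdeg]
    calc (d : ℝ) * θ ≤ (g.totalDegree : ℝ) * θ :=
          mul_le_mul_of_nonneg_right (by exact_mod_cast hdle) hθ.le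
      _ < Real.pi / 2 := hlt
  have hpos := stub_positiveVanishingDegree (homogeneousComponent d g) hFd ![θ, 0, 0] θ
    (fun e => by fin_cases e <;> simp [abs_of_pos hθ, hθ.le]) hdeg
  have htorus : (fun e => Complex.exp ((((![θ, 0, 0] : Fin 3 → ℝ) e : ℝ) : ℂ) * Complex.I)) =
      ![ω, 1, 1] := by
    funext e
    fin_cases e <;> simp [hω]
  have hval : eval₂ φ ![ω, 1, 1] (homogeneousComponent d g) = a d :=
    eval₂_congr_of_free φ hFsupp fun j hj => by
      fin_cases j <;> simp [hx₀] at hj ⊢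
  rw [htorus, eval_map, hval, ha0 d (Finset.mem_range.2 (Nat.lt_succ_of_le hdle)),
    Complex.zero_re] at hpos
  exact lt_irrefl 0 hpos

/-! ### Complex points of the parametrised conic -/

/-- **The relation at the complex points `(ω s, s)` of the parameter plane.**  For `ω = e^{iθ}`,
`0 < θ < π`, the parametrisation `P = (a(a+b), b(a+b), −(a² − 2cos θ·ab + b²))` at
`(a, b) = (ω s, s)` equals `(Λ s²)·(ω, 1, 0)` with `Λ = ω + 1 ≠ 0` (`ω² − 2cos θ·ω + 1 = 0`); as
`Λ s²` ranges over all of `ℂ`, a polynomial `Ĝ ∈ ℝ≥0[z]` with `Ĝ(P) = 0` vanishes at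
`c·(ω, 1, 0)` for every `c ∈ ℂ`. [folklore] -/
theorem vanishing_of_relation (θ : ℝ) (hθ : 0 < θ) (hθπ : θ < Real.pi)
    (Ĝ : MvPolynomial (Fin 3) ℝ≥0)
    (hrel : MvPolynomial.aeval
      (![X 0 * (X 0 + X 1), X 1 * (X 0 + X 1),
         -(X 0 ^ 2 - C (2 * Real.cos θ) * X 0 * X 1 + X 1 ^ 2)] :
        Fin 3 → MvPolynomial (Fin 2) ℝ) (MvPolynomial.map NNReal.toRealHom Ĝ) = 0) (c : ℂ) :
    eval₂ (Complex.ofRealHom.comp NNReal.toRealHom)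
      (c • ![Complex.exp (θ * Complex.I), 1, 0]) Ĝ = 0 := by
  set ω : ℂ := Complex.exp (θ * Complex.I) with hω
  -- `ω ω⁻¹ = 1` and `ω² - 2 cos θ ω + 1 = 0`
  have hinv : ω * Complex.exp (-(θ : ℂ) * Complex.I) = 1 := by
    rw [hω, ← Complex.exp_add, neg_mul, add_neg_cancel, Complex.exp_zero]
  have hquad : ω ^ 2 - 2 * Complex.cos θ * ω + 1 = 0 := by
    rw [Complex.two_cos, ← hω]
    linear_combination (-1 : ℂ) * hinv
  -- `Λ = ω + 1 ≠ 0`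
  have hΛ : ω + 1 ≠ 0 := by
    intro h
    have him : (ω + 1).im = Real.sin θ := by
      rw [Complex.add_im, hω, Complex.exp_ofReal_mul_I_im, Complex.one_im, add_zero]
    have hsin := Real.sin_pos_of_pos_of_lt_pi hθ hθπ
    rw [← him, h, Complex.zero_im] at hsin
    exact lt_irrefl 0 hsin
  -- `c = Λ s²`
  obtain ⟨s, hs⟩ := IsAlgClosed.exists_pow_nat_eq (c / (ω + 1)) (by norm_num : 0 < 2)
  have hc : (ω + 1) * s ^ 2 = c := by
    rw [hs]
    field_simp
  -- evaluate the relation at `(ω s, s)`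
  have h := congr_arg (MvPolynomial.aeval ![ω * s, s]) hrel
  rw [map_zero, comp_aeval_apply, aeval_def, eval₂_map] at h
  have halg : (algebraMap ℝ ℂ).comp NNReal.toRealHom = Complex.ofRealHom.comp NNReal.toRealHom :=
    RingHom.ext fun x => rfl
  have hpt : (fun i => MvPolynomial.aeval ![ω * s, s]
      ((![X 0 * (X 0 + X 1), X 1 * (X 0 + X 1),
         -(X 0 ^ 2 - C (2 * Real.cos θ) * X 0 * X 1 + X 1 ^ 2)] :
        Fin 3 → MvPolynomial (Fin 2) ℝ) i)) = c • ![ω, 1, 0] := by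
    funext i
    fin_cases i
    · simp only [Nat.succ_eq_add_one, Nat.reduceAdd, Fin.isValue, neg_add_rev, neg_sub,
        Fin.zero_eta, Matrix.cons_val_zero, map_mul, aeval_X, map_add, Matrix.cons_val_one,
        Matrix.cons_val_fin_one, Pi.smul_apply, smul_eq_mul]
      linear_combination ω * hc
    · simp only [Nat.succ_eq_add_one, Nat.reduceAdd, Fin.isValue, neg_add_rev, neg_sub,
        Fin.mk_one, Matrix.cons_val_one, Matrix.cons_val_zero, map_mul, aeval_X,
        Matrix.cons_val_fin_one, map_add, Pi.smul_apply, smul_eq_mul, mul_one]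
      linear_combination hc
    · simp only [Nat.succ_eq_add_one, Nat.reduceAdd, Fin.isValue, neg_add_rev, neg_sub,
        Fin.reduceFinMk, Matrix.cons_val, map_add, map_neg, map_pow, aeval_X, Matrix.cons_val_one,
        Matrix.cons_val_fin_one, map_sub, map_mul, algHom_C, Complex.coe_algebraMap,
        Complex.ofReal_ofNat, Complex.ofReal_cos, Matrix.cons_val_zero, Pi.smul_apply, smul_eq_mul,
        mul_zero]
      linear_combination (-s ^ 2) * hquad
  rwa [halg, hpt] at h

/-! ### The theorem -/

/-- **The induction.** For a nonzero `Ĝ ∈ ℝ≥0[z₀, z₁, z₂]` whose real image kills the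
parametrisation, `deg Ĝ · θ ≥ π/2`: write `Ĝ = z₂ Ĝ' + ĝ` with `ĝ` free of `z₂`; if `ĝ ≠ 0` apply
`gap_of_vanishing` to `ĝ` (it vanishes on the line `ℂ·(ω,1,0)` by `vanishing_of_relation`, the
third coordinate being `0`), and `deg ĝ ≤ deg Ĝ`; if `ĝ = 0` then `Ĝ' ≠ 0` kills the
parametrisation too (`P₂ ≠ 0` in the domain `ℝ[a,b]`) and has degree `deg Ĝ - 1`. [folklore] -/
theorem gap_nnreal (θ : ℝ) (hθ : 0 < θ) (hθπ : θ < Real.pi) (Ĝ : MvPolynomial (Fin 3) ℝ≥0)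
    (hĜ : Ĝ ≠ 0)
    (hrel : MvPolynomial.aeval
      (![X 0 * (X 0 + X 1), X 1 * (X 0 + X 1),
         -(X 0 ^ 2 - C (2 * Real.cos θ) * X 0 * X 1 + X 1 ^ 2)] :
        Fin 3 → MvPolynomial (Fin 2) ℝ) (MvPolynomial.map NNReal.toRealHom Ĝ) = 0) :
    Real.pi / 2 ≤ (Ĝ.totalDegree : ℝ) * θ := by
  set P : Fin 3 → MvPolynomial (Fin 2) ℝ := ![X 0 * (X 0 + X 1), X 1 * (X 0 + X 1),
         -(X 0 ^ 2 - C (2 * Real.cos θ) * X 0 * X 1 + X 1 ^ 2)] with hP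
  -- the third coordinate of the parametrisation is a nonzero polynomial
  have hP2 : P 2 ≠ 0 := by
    intro h
    have := congr_arg (MvPolynomial.eval ![(1 : ℝ), 0]) h
    simp [hP] at this
  suffices key : ∀ N (H : MvPolynomial (Fin 3) ℝ≥0), H.totalDegree = N → H ≠ 0 →
      MvPolynomial.aeval P (MvPolynomial.map NNReal.toRealHom H) = 0 →
      Real.pi / 2 ≤ (H.totalDegree : ℝ) * θ from key _ Ĝ rfl hĜ hrel
  intro N
  induction N using Nat.strong_induction_on with
  | _ N ih =>
    intro H hN hH hrelH
    set H' := H.divMonomial (Finsupp.single 2 1)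
    set g := H.modMonomial (Finsupp.single 2 1)
    have hdec : X 2 * H' + g = H := divMonomial_add_modMonomial_single H 2
    by_cases hg0 : g = 0
    · -- `H = z₂ · H'`: divide and use the induction hypothesis
      have hHeq : H = X 2 * H' := by rw [hg0, add_zero] at hdec; exact hdec.symm
      have hH' : H' ≠ 0 := by
        rintro h
        rw [h, mul_zero] at hHeq
        exact hH hHeq
      have hdegH : H.totalDegree = H'.totalDegree + 1 := by
        rw [hHeq, totalDegree_mul_of_isDomain (X_ne_zero _) hH', totalDegree_X, add_comm]
      have hrel' : MvPolynomial.aeval P (MvPolynomial.map NNReal.toRealHom H') = 0 := by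
        rw [hHeq, map_mul, map_X, map_mul, aeval_X] at hrelH
        exact (mul_eq_zero.1 hrelH).resolve_left hP2
      have hlt : H'.totalDegree < N := by rw [← hN, hdegH]; exact Nat.lt_succ_self _
      have := ih _ hlt H' rfl hH' hrel'
      calc Real.pi / 2 ≤ (H'.totalDegree : ℝ) * θ := this
        _ ≤ (H.totalDegree : ℝ) * θ := by
          refine mul_le_mul_of_nonneg_right ?_ hθ.le
          have hle : H'.totalDegree ≤ H.totalDegree := hdegH ▸ Nat.le_succ _
          exact_mod_cast hle
    · -- `g ≠ 0`: the analytic heart applied to `g`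
      have hsupp : ∀ m ∈ g.support, m 2 = 0 := fun m hm => (mem_support_modMonomial_single hm).1
      have hvan : ∀ c : ℂ, eval₂ (Complex.ofRealHom.comp NNReal.toRealHom)
          (c • ![Complex.exp (θ * Complex.I), 1, 0]) g = 0 := by
        intro c
        have h := vanishing_of_relation θ hθ hθπ H hrelH c
        rw [← hdec, eval₂_add, eval₂_mul, eval₂_X] at h
        simpa using h
      have hgap := gap_of_vanishing θ hθ g hg0 hsupp hvan
      calc Real.pi / 2 ≤ (g.totalDegree : ℝ) * θ := hgap
        _ ≤ (H.totalDegree : ℝ) * θ := by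
          have hle : g.totalDegree ≤ H.totalDegree :=
            totalDegree_le_of_support_subset fun m hm => (mem_support_modMonomial_single hm).2
          exact mul_le_mul_of_nonneg_right (by exact_mod_cast hle) hθ.le

/-- **stub_parametrizedConicGap — THE POSITIVITY GAP OF THE CONIC `F_θ`.**  Let `0 < θ < π` and
let a nonzero NONNEGATIVE `G ∈ ℝ[z₀,z₁,z₂]` kill the parametrisation
`(a(a+b), b(a+b), −(a² − 2cos θ·ab + b²))` of the conic `F_θ = z₀² − 2cos θ z₀z₁ + z₁² + z₂(z₀+z₁)`.
Then `deg G · θ ≥ π/2`.  Proof: along the complex line `a = e^{iθ}b` the third coordinate vanishes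
and the first two are `(e^{iθ}, 1)·λb²` with `λ = 1 + e^{iθ} ≠ 0`; so `g := G(z₀,z₁,0)` vanishes
on the line `z₀ = e^{iθ}z₁`, hence every homogeneous component `g_d` has `g_d(e^{iθ},1) = 0`; a
nonzero `g_d` lifted to `ℝ≥0` contradicts `stub_positiveVanishingDegree` at phases `(θ,0,0)`,
`ε = θ` unless `d θ ≥ π/2`; if `g = 0` then `G = z₂·G'` and one inducts on the degree
(`gap_nnreal`). [folklore] -/
theorem stub_parametrizedConicGap (θ : ℝ) (hθ : 0 < θ) (hθπ : θ < Real.pi)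
    (G : MvPolynomial (Fin 3) ℝ) (hG : ∀ m, 0 ≤ coeff m G) (hG0 : G ≠ 0)
    (hrel : MvPolynomial.aeval
      (![X 0 * (X 0 + X 1), X 1 * (X 0 + X 1),
         -(X 0 ^ 2 - C (2 * Real.cos θ) * X 0 * X 1 + X 1 ^ 2)] :
        Fin 3 → MvPolynomial (Fin 2) ℝ) G = 0) :
    Real.pi / 2 ≤ (G.totalDegree : ℝ) * θ := by
  obtain ⟨Ĝ, rfl⟩ := exists_lift_of_coeff_nonneg G hG
  rw [totalDegree_map_toRealHom]
  have hĜ : Ĝ ≠ 0 := by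
    rintro rfl
    exact hG0 (map_zero _)
  exact gap_nnreal θ hθ hθπ Ĝ hĜ hrel

end Summit.ValiantsHypothesis.ValiantsHypothesis.Theorems.DivisionGap.PerCofactorDegreeReduction.ParametrizedConicGap

end
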